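import Literature.AlgebraicGeometry.ComplexMultiplication.CyclotomicFermatCMTypesBadOddCharacterCount
import HarnessLib

/-!
# Koblitz–Rohrlich's PROPOSITION at two-prime levels `N = pᵃqᵇ` — the arithmetic half ("Case 1. `m = 2`") — and THEOREMS 1 (i)–(ii), 2
# in the relatively prime case UNCONDITIONALLY at such levels

Layer `Literature/AlgebraicGeometry/ComplexMultiplication`, namespace `…ComplexMultiplication.CyclotomicFermatCMType`; sequel of
`CyclotomicFermatCMTypesBadOddCharacterCount` (the structural half of the count: `#S₀(N) ≤ Σ_{r ∣ N} #{ψ mod N_r odd : ψ(r) = 1}`,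
`2·ord·# = φ(N_r)` or `# = 0`) and of `CyclotomicFermatCMTypesOddLevelSimple` (Theorems 1–2 at any odd level under `12·#S₀(N) < φ(N)`).
THEOREMS ONLY (no definition, no named fact, no `sorry`).  Koblitz–Rohrlich, §2 Proposition (p. 1190) "Suppose `2, 3 ∤ N` … Then
`#S₀(N) < (1/6)#S(N)`", proof pp. 1190–1191: "We claim that this sum is `< 1/6`.  It clearly suffices to prove this when all `aᵢ = 1`. …
Note that `ordᵢ ≥ log_{pᵢ} Nᵢ ≥ m − i`.  Thus (1) `ordᵢ ≥ m + 1 − i`.  Also, (2) `ord_m = 1` only if `p_m ≡ 1 (mod p₁⋯p_{m−1})`. Case 1. `m = 2`,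
`s(N) = 1/((p₁ − 1)ord₁) + 1/((p₂ − 1)ord₂)`.  By Table 1, if `p₁ = 5` or `7`, then `ord₁ ≥ 3` with equality only if `p₂ = 31` or `19`.  If
`p₁ ≥ 11`, then `(p₁ − 1)ord₁ ≥ 20` by (1).  Thus in either case `s(N) ≤ …` if `p₂ ≥ 13` (with at least one `≤` strict).  For the remaining
case `p₁ = 5`, `p₂ = 11`: `s(55) = 1/4·5 + 1/10 = 3/20 < 1/6`."  THIS FILE proves the Proposition's inequality `12·#S₀(N) < φ(N)` for EVERY
`N = pᵃqᵇ` with distinct primes `p, q ≥ 5` and `a, b ≥ 1` (K–R's `m = 2`, including the prime-power exponents K–R reduce away), and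
derives Theorems 1 (i)–(ii) and 2 there with no hypothesis left.

## The print

* N. Koblitz, D. Rohrlich, *Simple factors in the Jacobian of a Fermat curve*, Canad. J. Math. **30** (1978) 1183–1205
  [KoblitzRohrlich1978] (held `paper:koblitz1978-simple-factors-jacobian-fermat-curve`, pp. 1185–1191 read): Theorem 1 (i)–(ii), Theorem 2
  (pp. 1185–1186), §2 Proposition and its proof, Case 1 (pp. 1190–1191), quoted above; "TABLE 1. All primes `≥ 5` dividing `pᵐ − 1` for
  certain `p` and `m`" (p. 1190; the entries used here: `5³ − 1 = 4·31`).
* G. Shimura, *Abelian Varieties with Complex Multiplication and Modular Functions* (1998) [Shimura1998], §8.2 Prop. 26, §8.4 Example (1),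
  §6.1 Corollary, §6.2 Theorem 3 (through the siblings).

## What is proved

* §1 (units modulo an odd prime power `qᵇ`): a unit has a power equal to `−1` iff its order is even (`exists_pow_eq_neg_one_of_even_orderOf`
  via `x² = 1 ⟹ x = ±1`; conversely `(−1)^{odd} ≠ 1`), and the test descends to `q`: `mʲ ≡ −1 (mod q)` for some `j` ⟹ some power of `m` is
  `−1` modulo `qᵇ` (`exists_pow_eq_neg_one_of_pow_natCast_eq_neg_one`; the order mod `q` divides the order mod `qᵇ`).
* §2 (one side `A(m; qᵇ) = #{ψ mod qᵇ odd : ψ(m) = 1}`): **`card_side_dichotomy`** — `A = 0`, or the order `d` of `m` modulo `qᵇ` is odd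
  and `2dA = φ(qᵇ)`; `card_side_eq_zero_of_pow_natCast_eq_neg_one` (killed when `mʲ ≡ −1 (mod q)`); `two_mul_card_side_le` (`2A ≤ φ(qᵇ)`).
* §3 **Case `m = 2`** `twelve_mul_card_sides_lt_of_lt` / `twelve_mul_card_sides_lt`: for distinct primes `p, q ≥ 5`, `a, b ≥ 1`:
  **`12·(A(p; qᵇ) + A(q; pᵃ)) < φ(pᵃ)φ(qᵇ)`**.  Route (for `p < q`): `{p, q} = {5, 7}` — both sides vanish (`5³ ≡ −1 (7)`, `7² ≡ −1 (5)`);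
  else `q ≥ 11`, `2A(q; pᵃ) ≤ φ(pᵃ)`, and `A(p; qᵇ) = 0` or `d = ord_{qᵇ}(p)` is odd, `≠ 1` (`p ≢ 1 (mod qᵇ)` as `1 < p < qᵇ`), so `≥ 3`,
  with `2dA = φ(qᵇ)`: for `φ(pᵃ) ≥ 6` the bounds `6A ≤ φ(qᵇ)`, `φ(qᵇ) ≥ 10` suffice; for `pᵃ = 5`: `d = 3` gives `q ∣ 5³ − 1 = 124`, `q = 31`,
  `φ(qᵇ) ≥ 30`; `d ≥ 4` gives `8A ≤ φ(qᵇ)` (the arithmetic is isolated in `twelve_mul_lt_of_bounds`).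
* §4 **THE PROPOSITION AT TWO-PRIME LEVELS**: `twelve_mul_sum_card_lt_totient` (`12·Σ_{r∣N} #{ψ mod N_r odd : ψ(r) = 1} < φ(N)` for
  `N = pᵃqᵇ`), **`twelve_mul_card_bad_lt_totient`** (`12·#{χ mod N odd : B_{1,χ} = 0} < φ(N)`, i.e. `#S₀(N) < #S(N)/6`), and the sibling's
  hypothesis `exists_goodFinset_two_primes`.
* §5 **THEOREMS 1 (i)–(ii) AND 2, RELATIVELY PRIME CASE, UNCONDITIONALLY AT `N = pᵃqᵇ`** (`p ≠ q` primes `≥ 5`): `H_{r',s',t'} = h⁻¹H_{r,s,t}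
  ⟺ {r',s',t'} = {hr,hs,ht}` (`forall_mem_fermatCMType_iff_iff_multiset_eq_twoPrimes`), (∗) `fermatCMType_eq_iff_multiset_eq_twoPrimes`,
  the stabiliser `forall_mem_fermatCMType_one_iff_mul_mem_iff_twoPrimes`, `isPrimitive_fermat_one_iff_twoPrimes` /
  `isSimple_of_fermat_one_iff_twoPrimes` (`Φ_{(1,a₀,−1−a₀)}` primitive — its abelian varieties simple — iff `¬(1 + a₀ + a₀² = 0 ∧ a₀ ≠ 1)`),
  `isIsogenous_fermatCMType_iff_exists_multiset_eq_twoPrimes` ("the only isogenies … are the obvious equalities"), non-vacuity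
  `exists_isSimple_of_fermat_one_twoPrimes`.

## Honest column / NOT here

* Only `m = 2` prime factors (any exponents); K–R's Cases 2–4 (`m = 3, 4`, `5 ≤ m ≤ 9`) and `m ≥ 10` (pp. 1191–1193) are NOT typed, so at
  levels with three or more prime factors Theorems 1–2 remain conditional on `12·#S₀(N) < φ(N)` (sibling `…OddLevelSimple`).
* K–R reduce to `aᵢ = 1` and bound `s(N)`; here the exponents are carried along (the side counts at `qᵇ`, `pᵃ` are compared with `φ(pᵃ)φ(qᵇ)`
  directly) — same inequality, slightly different bookkeeping; Table 1 is used only through `5³ − 1 = 4·31` (the entry `p = 5`, `m = 3`), the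
  case `p = 7`, `ord = 3`, `q = 19` of the print being absorbed by the generic bound.
* Relatively prime case only (unit triples, `M = N`); boundary cases §§3–5 and Theorems 3–4 not typed; as in the siblings the statements are
  about `H_{r,s,t}`, the CM types and all abelian varieties of those types, not about the Fermat Jacobian itself.
* Private: `even_orderOf_of_pow_eq_neg_one`, `dvd_pow_orderOf_sub_one`, `orderOf_unitOfCoprime_eq_one_iff`, `isUnit_iff_castHom_ne_zero'`,
  `eq_one_or_eq_neg_one_of_sq_eq_one`, `card_side_eq_card_unit`, `card_level_congr`, `prime_ge_five_cases`, `twelve_mul_lt_of_bounds`, two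
  `decide` facts, `ordCompl_pow_mul_pow`, `level_hyps₂`.

## References

* [KoblitzRohrlich1978] N. Koblitz, D. Rohrlich, Canad. J. Math. 30 (1978) 1183–1205: Theorems 1–2 (pp. 1185–1186), §2 Proposition and
  Case 1 (pp. 1190–1191), Table 1 (p. 1190).
* [Shimura1998] G. Shimura, *Abelian Varieties with Complex Multiplication and Modular Functions*, §6.1–6.2, §8.2 Prop. 26, §8.4 Example (1).
* [Washington1997] L. C. Washington, *Introduction to Cyclotomic Fields*, Cor. 4.4.

## Provenance

Cell `pub-hodgecm2` (COR-CM), literature seat `lit-deligne-3` gen 34 (claim KR78-BADCOUNT F2; count-neutral, own lane).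
-/

noncomputable section

open NumberField

namespace Literature.AlgebraicGeometry.ComplexMultiplication

open Literature.NumberTheory.ComplexMultiplication
open Literature.NumberTheory.LFunctions

namespace CyclotomicFermatCMType

/-! ## §1 Units modulo an odd prime power: square roots of `1`, powers equal to `−1`, orders under reduction -/

section Units

variable {M : ℕ} [NeZero M]

omit [NeZero M] in
/-- If a power of a unit `u` of `ℤ/M` (`M > 2`) is `−1`, the order of `u` is even (`(−1)^{odd} ≠ 1`). [folklore] -/
private theorem even_orderOf_of_pow_eq_neg_one (hM : 2 < M) {u : (ZMod M)ˣ} {j : ℕ} (hj : u ^ j = -1) :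
    Even (orderOf u) := by
  by_contra hodd
  rw [Nat.not_even_iff_odd] at hodd
  have h1 : (u ^ j) ^ orderOf u = 1 := by rw [← pow_mul, mul_comm, pow_mul, pow_orderOf_eq_one, one_pow]
  rw [hj, hodd.neg_one_pow] at h1
  have h2 : ((-1 : (ZMod M)ˣ) : ZMod M) = 1 := by rw [h1, Units.val_one]
  rw [Units.val_neg, Units.val_one] at h2
  have h3 : ((2 : ℕ) : ZMod M) = 0 := by
    rw [Nat.cast_ofNat]
    linear_combination -h2
  rw [ZMod.natCast_eq_zero_iff] at h3
  exact absurd (Nat.le_of_dvd two_pos h3) (not_le.2 hM)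

/-- `M ∣ m^{ord(m)} − 1` for `m` prime to `M` (`ord` = the order of `m` in `(ℤ/M)ˣ`). [folklore] -/
private theorem dvd_pow_orderOf_sub_one {m : ℕ} (hm : m.Coprime M) :
    M ∣ m ^ orderOf (ZMod.unitOfCoprime m hm) - 1 := by
  have hu : ((m : ZMod M)) ^ orderOf (ZMod.unitOfCoprime m hm) = 1 := by
    rw [← ZMod.coe_unitOfCoprime m hm, ← Units.val_pow_eq_pow_val, pow_orderOf_eq_one, Units.val_one]
  rcases Nat.eq_zero_or_pos m with h0 | hpos
  · subst h0
    have hM : M = 1 := (Nat.coprime_zero_left _).1 hm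
    subst hM
    exact one_dvd _
  have h1 : 1 ≤ m ^ orderOf (ZMod.unitOfCoprime m hm) := Nat.one_le_pow _ _ hpos
  have h : ((m ^ orderOf (ZMod.unitOfCoprime m hm) - 1 : ℕ) : ZMod M) = 0 := by
    rw [Nat.cast_sub h1, Nat.cast_pow, Nat.cast_one, hu, sub_self]
  exact (ZMod.natCast_eq_zero_iff _ _).1 h

omit [NeZero M] in
/-- The order of `m` modulo `M` is `1` iff `m ≡ 1 (mod M)`. [folklore] -/
private theorem orderOf_unitOfCoprime_eq_one_iff {m : ℕ} (hm : m.Coprime M) :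
    orderOf (ZMod.unitOfCoprime m hm) = 1 ↔ (m : ZMod M) = 1 := by
  rw [orderOf_eq_one_iff, ← ZMod.coe_unitOfCoprime m hm]
  exact ⟨fun h => by rw [h, Units.val_one], fun h => Units.ext (h.trans Units.val_one.symm)⟩

end Units

section PrimePowUnits

variable {q : ℕ} [hq : Fact q.Prime] {b : ℕ}

/-- A residue modulo `qᵇ` (`b ≥ 1`) is a unit iff its reduction modulo `q` is non-zero (private copy of the sibling's). [folklore] -/
private theorem isUnit_iff_castHom_ne_zero' (hb : b ≠ 0) (x : ZMod (q ^ b)) :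
    IsUnit x ↔ ZMod.castHom (dvd_pow_self q hb) (ZMod q) x ≠ 0 := by
  haveI : NeZero (q ^ b) := ⟨pow_ne_zero b hq.out.ne_zero⟩
  have hx : ((x.val : ℕ) : ZMod (q ^ b)) = x := ZMod.natCast_zmod_val x
  rw [← hx, map_natCast, ZMod.isUnit_iff_coprime, ne_eq, ZMod.natCast_eq_zero_iff,
    Nat.coprime_pow_right_iff (Nat.pos_of_ne_zero hb), Nat.coprime_comm, hq.out.coprime_iff_not_dvd]

/-- **`x² = 1 ⟹ x = ±1` modulo an odd prime power** (`(x − 1)(x + 1) = 0` and `q` cannot divide both factors, which differ by `2`).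
[folklore] -/
private theorem eq_one_or_eq_neg_one_of_sq_eq_one (hq2 : q ≠ 2) (hb : b ≠ 0) {x : ZMod (q ^ b)} (hx : x ^ 2 = 1) :
    x = 1 ∨ x = -1 := by
  haveI : NeZero (q ^ b) := ⟨pow_ne_zero b hq.out.ne_zero⟩
  have hfac : (x - 1) * (x + 1) = 0 := by linear_combination hx
  let π : ZMod (q ^ b) →+* ZMod q := ZMod.castHom (dvd_pow_self q hb) (ZMod q)
  by_cases h : IsUnit (x - 1)
  · right
    obtain ⟨v, hv⟩ := h
    have := congrArg (fun y => ((v⁻¹ : (ZMod (q ^ b))ˣ) : ZMod (q ^ b)) * y) hfac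
    simp only [← hv, ← mul_assoc, Units.inv_mul, one_mul, mul_zero] at this
    linear_combination this
  · left
    have hπ : π (x - 1) = 0 := by
      rw [isUnit_iff_castHom_ne_zero' hb, not_not] at h
      exact h
    have h2 : IsUnit (x + 1) := by
      rw [isUnit_iff_castHom_ne_zero' hb]
      intro h0
      have e : π (x + 1) = π (x - 1) + 2 := by rw [map_add, map_sub, map_one]; ring
      rw [hπ, zero_add] at e
      have h3 : ((2 : ℕ) : ZMod q) = 0 := by rw [Nat.cast_ofNat, ← e]; exact h0
      rw [ZMod.natCast_eq_zero_iff] at h3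
      exact hq2 ((Nat.prime_dvd_prime_iff_eq hq.out Nat.prime_two).1 h3)
    obtain ⟨v, hv⟩ := h2
    have := congrArg (fun y => y * ((v⁻¹ : (ZMod (q ^ b))ˣ) : ZMod (q ^ b))) hfac
    simp only [← hv, mul_assoc, Units.mul_inv, mul_one, zero_mul] at this
    linear_combination this

/-- **A unit of EVEN order modulo an odd prime power has a power equal to `−1`** (`u^{ord/2}` is a square root of `1` other than `1`) —
the test behind K–R's "`0` if `pᵢ` is a root of `−1 mod Nᵢ`" at a prime-power `Nᵢ`. [cite: KoblitzRohrlich1978, §2 proof of the Proposition (p. 1190)] -/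
theorem exists_pow_eq_neg_one_of_even_orderOf (hq2 : q ≠ 2) (hb : b ≠ 0) {u : (ZMod (q ^ b))ˣ}
    (he : Even (orderOf u)) : ∃ j : ℕ, u ^ j = -1 := by
  haveI : NeZero (q ^ b) := ⟨pow_ne_zero b hq.out.ne_zero⟩
  obtain ⟨k, hk⟩ := he
  have hk0 : k ≠ 0 := by
    intro h0
    rw [h0] at hk
    exact (orderOf_pos u).ne' hk
  have hsq : ((u ^ k : (ZMod (q ^ b))ˣ) : ZMod (q ^ b)) ^ 2 = 1 := by
    rw [← Units.val_pow_eq_pow_val, ← pow_mul, show k * 2 = orderOf u by omega, pow_orderOf_eq_one, Units.val_one]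
  have hne : u ^ k ≠ 1 := pow_ne_one_of_lt_orderOf hk0 (by omega)
  refine ⟨k, ?_⟩
  rcases eq_one_or_eq_neg_one_of_sq_eq_one hq2 hb hsq with h1 | h1
  · exact absurd (Units.ext (h1.trans Units.val_one.symm)) hne
  · exact Units.ext (h1.trans (by rw [Units.val_neg, Units.val_one]))

/-- **Reduction modulo `q` detects `−1 ∈ ⟨m⟩`**: if some power of `m` is `−1` modulo `q`, then some power of `m` is `−1` modulo `qᵇ` (the
order of `m` mod `q` is even and divides the order mod `qᵇ`) — K–R's "`pᵢ` is a root of `−1 mod Nᵢ`" read off modulo the prime.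
[cite: KoblitzRohrlich1978, §2 proof of the Proposition (p. 1190)] -/
theorem exists_pow_eq_neg_one_of_pow_natCast_eq_neg_one (hq2 : q ≠ 2) (hb : b ≠ 0) {m : ℕ} (hm : m.Coprime (q ^ b))
    {j : ℕ} (hj : ((m : ZMod q)) ^ j = -1) : ∃ j' : ℕ, (ZMod.unitOfCoprime m hm) ^ j' = -1 := by
  haveI : NeZero (q ^ b) := ⟨pow_ne_zero b hq.out.ne_zero⟩
  have hmq : m.Coprime q := (Nat.coprime_pow_right_iff (Nat.pos_of_ne_zero hb) m q).1 hm
  let ubar : (ZMod q)ˣ := ZMod.unitOfCoprime m hmq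
  have hubar : ubar ^ j = -1 := Units.ext (by
    rw [Units.val_pow_eq_pow_val, ZMod.coe_unitOfCoprime, Units.val_neg, Units.val_one]; exact hj)
  have hq3 : 2 < q := by
    have := hq.out.two_le
    omega
  have heven : Even (orderOf ubar) := even_orderOf_of_pow_eq_neg_one hq3 hubar
  let π : (ZMod (q ^ b))ˣ →* (ZMod q)ˣ := Units.map (ZMod.castHom (dvd_pow_self q hb) (ZMod q)).toMonoidHom
  have hπ : π (ZMod.unitOfCoprime m hm) = ubar := Units.ext (by
    simp only [π, ubar, Units.coe_map, RingHom.toMonoidHom_eq_coe, MonoidHom.coe_coe, ZMod.coe_unitOfCoprime,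
      map_natCast])
  have hdvd : orderOf ubar ∣ orderOf (ZMod.unitOfCoprime m hm) := by
    rw [← hπ]
    exact orderOf_map_dvd π _
  exact exists_pow_eq_neg_one_of_even_orderOf hq2 hb
    ((even_iff_two_dvd).2 (dvd_trans (even_iff_two_dvd.1 heven) hdvd))

end PrimePowUnits

/-! ## §2 One side of the count at a two-prime level: `A(m; qᵇ) = #{ψ mod qᵇ odd : ψ(m) = 1}` -/

section Side

variable {q : ℕ} [hq : Fact q.Prime] {b : ℕ}

/-- Reading `ψ(m) = 1` on the unit `m ∈ (ℤ/M)ˣ`. [folklore] -/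
private theorem card_side_eq_card_unit {M : ℕ} [NeZero M] {m : ℕ} (hm : m.Coprime M) :
    Nat.card {ψ : DirichletCharacter ℂ M // ψ.Odd ∧ ψ (m : ZMod M) = 1} =
      Nat.card {ψ : DirichletCharacter ℂ M // ψ.Odd ∧ ψ (ZMod.unitOfCoprime m hm) = 1} := by
  refine Nat.card_congr (Equiv.subtypeEquivRight fun ψ => ?_)
  rw [ZMod.coe_unitOfCoprime]

/-- **Dichotomy for one side of Koblitz–Rohrlich's count at an odd prime-power modulus**: for `m` prime to `qᵇ` (`q` odd), the number
`A = #{ψ mod qᵇ odd : ψ(m) = 1}` is `0`, or the order `d` of `m` modulo `qᵇ` is ODD and `2d·A = φ(qᵇ)` (in `(ℤ/qᵇ)ˣ` a unit has a power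
equal to `−1` iff its order is even). [cite: KoblitzRohrlich1978, §2 proof of the Proposition (p. 1190)] -/
theorem card_side_dichotomy (hq2 : q ≠ 2) (hb : b ≠ 0) {m : ℕ} (hm : m.Coprime (q ^ b)) :
    Nat.card {ψ : DirichletCharacter ℂ (q ^ b) // ψ.Odd ∧ ψ (m : ZMod (q ^ b)) = 1} = 0 ∨
      (Odd (orderOf (ZMod.unitOfCoprime m hm)) ∧
        2 * orderOf (ZMod.unitOfCoprime m hm) *
          Nat.card {ψ : DirichletCharacter ℂ (q ^ b) // ψ.Odd ∧ ψ (m : ZMod (q ^ b)) = 1} = (q ^ b).totient) := by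
  haveI : NeZero (q ^ b) := ⟨pow_ne_zero b hq.out.ne_zero⟩
  rw [card_side_eq_card_unit hm]
  by_cases h : ∃ j : ℕ, (ZMod.unitOfCoprime m hm) ^ j = -1
  · obtain ⟨j, hj⟩ := h
    exact Or.inl (card_odd_apply_eq_one_eq_zero _ hj)
  · right
    have hodd : Odd (orderOf (ZMod.unitOfCoprime m hm)) := by
      rw [← Nat.not_even_iff_odd]
      exact fun he => h (exists_pow_eq_neg_one_of_even_orderOf hq2 hb he)
    exact ⟨hodd, two_mul_orderOf_mul_card_odd_apply_eq_one _ fun j hj => h ⟨j, hj⟩⟩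

/-- **The side is killed by a power `≡ −1 (mod q)`**: if `mʲ ≡ −1 (mod q)` for some `j` then `#{ψ mod qᵇ odd : ψ(m) = 1} = 0` ("`0` if `pᵢ` is a
root of `−1 mod Nᵢ`", detected modulo `q`). [cite: KoblitzRohrlich1978, §2 proof of the Proposition (p. 1190)] -/
theorem card_side_eq_zero_of_pow_natCast_eq_neg_one (hq2 : q ≠ 2) (hb : b ≠ 0) {m : ℕ} (hm : m.Coprime (q ^ b))
    {j : ℕ} (hj : ((m : ZMod q)) ^ j = -1) :
    Nat.card {ψ : DirichletCharacter ℂ (q ^ b) // ψ.Odd ∧ ψ (m : ZMod (q ^ b)) = 1} = 0 := by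
  haveI : NeZero (q ^ b) := ⟨pow_ne_zero b hq.out.ne_zero⟩
  obtain ⟨j', hj'⟩ := exists_pow_eq_neg_one_of_pow_natCast_eq_neg_one hq2 hb hm hj
  rw [card_side_eq_card_unit hm]
  exact card_odd_apply_eq_one_eq_zero _ hj'

/-- **Universal bound for one side**: `2·#{ψ mod qᵇ odd : ψ(m) = 1} ≤ φ(qᵇ)` (at most half the characters). [cite: KoblitzRohrlich1978, §2 proof of the Proposition (p. 1190)] -/
theorem two_mul_card_side_le (hq2 : q ≠ 2) (hb : b ≠ 0) {m : ℕ} (hm : m.Coprime (q ^ b)) :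
    2 * Nat.card {ψ : DirichletCharacter ℂ (q ^ b) // ψ.Odd ∧ ψ (m : ZMod (q ^ b)) = 1} ≤ (q ^ b).totient := by
  rcases card_side_dichotomy hq2 hb hm with h0 | ⟨hodd, h⟩
  · rw [h0, mul_zero]
    exact Nat.zero_le _
  · rw [← h]
    exact Nat.mul_le_mul_right _ (Nat.mul_le_mul_left 2 hodd.pos)

end Side

/-! ## §3 The arithmetic half at two-prime levels `N = pᵃqᵇ` (`p ≠ q` primes `≥ 5`): `12·(A + B) < φ(N)` — K–R's "Case 1. `m = 2`" -/

section TwoPrimes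

/-- Transport of the side count along an equality of moduli. [folklore] -/
private theorem card_level_congr (r : ℕ) {M M' : ℕ} (h : M = M') :
    Nat.card {ψ : DirichletCharacter ℂ M // ψ.Odd ∧ ψ (r : ZMod M) = 1} =
      Nat.card {ψ : DirichletCharacter ℂ M' // ψ.Odd ∧ ψ (r : ZMod M') = 1} := by
  subst h
  rfl

/-- `7² ≡ −1 (mod 5)` (kernel computation). [folklore] -/
private theorem seven_sq_mod_five : (((7 : ℕ) : ZMod 5)) ^ 2 = -1 := by decide

/-- `5³ ≡ −1 (mod 7)` (kernel computation). [folklore] -/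
private theorem five_cube_mod_seven : (((5 : ℕ) : ZMod 7)) ^ 3 = -1 := by decide

/-- A natural number in `[5, 7)` or `(7, 11)` etc. is not prime: the primes `≥ 5` below `11` are `5` and `7`. [folklore] -/
private theorem prime_ge_five_cases {r : ℕ} (hr : r.Prime) (h5 : 5 ≤ r) : r = 5 ∨ r = 7 ∨ 11 ≤ r := by
  by_cases h11 : 11 ≤ r
  · exact Or.inr (Or.inr h11)
  · interval_cases r
    · exact Or.inl rfl
    · exact absurd hr (by decide)
    · exact Or.inr (Or.inl rfl)
    · exact absurd hr (by decide)
    · exact absurd hr (by decide)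
    · exact absurd hr (by decide)

/-- **The arithmetic of K–R's Case `m = 2`**, isolated: with `2B ≤ Φ₁`, `Φ₁ ≥ 4`, `Φ₂ ≥ 10`, and `A = 0` or (`d ≥ 3`, `2dA = Φ₂`, and
`Φ₂ ≥ 13` whenever `Φ₁ < 6` and `d = 3`), one has `12(A + B) < Φ₁Φ₂`. [cite: KoblitzRohrlich1978, §2 Proposition, Case 1 (p. 1191)] -/
private theorem twelve_mul_lt_of_bounds (A B Φ₁ Φ₂ d : ℕ) (hB2 : 2 * B ≤ Φ₁) (hΦ₁4 : 4 ≤ Φ₁) (hΦ₂10 : 10 ≤ Φ₂)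
    (hA : A = 0 ∨ (3 ≤ d ∧ 2 * d * A = Φ₂ ∧ (Φ₁ < 6 → d = 3 → 13 ≤ Φ₂))) :
    12 * (A + B) < Φ₁ * Φ₂ := by
  have h4Φ : 4 * Φ₂ ≤ Φ₁ * Φ₂ := Nat.mul_le_mul_right _ hΦ₁4
  rcases hA with hA0 | ⟨hd3, hA, hsmall⟩
  · rw [hA0, zero_add]
    have h10 : Φ₁ * 10 ≤ Φ₁ * Φ₂ := Nat.mul_le_mul_left _ hΦ₂10
    omega
  · have h6A : 6 * A ≤ Φ₂ := by
      rw [← hA]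
      calc 6 * A = 2 * 3 * A := by ring
        _ ≤ 2 * d * A := Nat.mul_le_mul_right _ (Nat.mul_le_mul_left 2 hd3)
    by_cases hΦ₁6 : 6 ≤ Φ₁
    · -- generic case: `12A ≤ 2Φ₂`, `12B ≤ 6Φ₁`, `(Φ₁ − 6)(Φ₂ − 10) ≥ 0`
      have key : (12 : ℤ) * (A + B) < Φ₁ * Φ₂ := by
        have h1 : (6 : ℤ) * A ≤ Φ₂ := by exact_mod_cast h6A
        have h2 : (2 : ℤ) * B ≤ Φ₁ := by exact_mod_cast hB2
        have h3 : (6 : ℤ) ≤ Φ₁ := by exact_mod_cast hΦ₁6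
        have h4 : (10 : ℤ) ≤ Φ₂ := by exact_mod_cast hΦ₂10
        nlinarith [mul_nonneg (sub_nonneg.2 h3) (sub_nonneg.2 h4)]
      exact_mod_cast key
    · -- `Φ₁ ∈ {4, 5}`: `12B ≤ 24`
      rw [not_le] at hΦ₁6
      by_cases hd : d = 3
      · have h13 := hsmall hΦ₁6 hd
        rw [hd] at hA
        omega
      · have hd4 : 4 ≤ d := by omega
        have h8A : 8 * A ≤ Φ₂ := by
          rw [← hA]
          calc 8 * A = 2 * 4 * A := by ring
            _ ≤ 2 * d * A := Nat.mul_le_mul_right _ (Nat.mul_le_mul_left 2 hd4)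
        omega

/-- **K–R's Case `m = 2`, ordered form**: for primes `5 ≤ p < q` and `a, b ≥ 1`, with `A = #{ψ mod qᵇ odd : ψ(p) = 1}` and
`B = #{ψ mod pᵃ odd : ψ(q) = 1}`: `12·(A + B) < φ(pᵃ)·φ(qᵇ)`.  (K–R, p. 1191: "Case 1. `m = 2`. … By Table 1, if `p₁ = 5` or `7`, then
`ord₁ ≥ 3` with equality only if `p₂ = 31` or `19`.  If `p₁ ≥ 11`, then `(p₁ − 1)ord₁ ≥ 20` … For the remaining case `p₁ = 5`, `p₂ = 11`:
`s(55) = 1/4·5 + 1/10 = 3/20 < 1/6`."  Here: both sides vanish for `{p, q} = {5, 7}` (`5³ ≡ −1 (7)`, `7² ≡ −1 (5)`); otherwise `q ≥ 11`,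
`2B ≤ φ(pᵃ)`, and `A = 0` or the order `d` of `p` modulo `qᵇ` is odd, `≥ 3`, with `2dA = φ(qᵇ)`; for `φ(pᵃ) ≥ 6` this suffices; for
`pᵃ = 5` and `d = 3`, `q ∣ 5³ − 1 = 124` forces `q = 31`.) [cite: KoblitzRohrlich1978, §2 Proposition, Case 1 (pp. 1190–1191)] -/
theorem twelve_mul_card_sides_lt_of_lt {p q a b : ℕ} [hp : Fact p.Prime] [hq : Fact q.Prime] (hp5 : 5 ≤ p) (hpq : p < q)
    (ha : a ≠ 0) (hb : b ≠ 0) :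
    12 * (Nat.card {ψ : DirichletCharacter ℂ (q ^ b) // ψ.Odd ∧ ψ (p : ZMod (q ^ b)) = 1} +
        Nat.card {ψ : DirichletCharacter ℂ (p ^ a) // ψ.Odd ∧ ψ (q : ZMod (p ^ a)) = 1}) <
      (p ^ a).totient * (q ^ b).totient := by
  haveI : NeZero (q ^ b) := ⟨pow_ne_zero b hq.out.ne_zero⟩
  haveI : NeZero (p ^ a) := ⟨pow_ne_zero a hp.out.ne_zero⟩
  have hp2 : p ≠ 2 := by omega
  have hq2 : q ≠ 2 := by omega
  have hpq' : p ≠ q := hpq.ne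
  have copr1 : p.Coprime (q ^ b) := ((Nat.coprime_primes hp.out hq.out).2 hpq').pow_right b
  have copr2 : q.Coprime (p ^ a) := ((Nat.coprime_primes hq.out hp.out).2 hpq'.symm).pow_right a
  -- the totients
  have hΦ₁ : (p ^ a).totient = p ^ (a - 1) * (p - 1) := Nat.totient_prime_pow hp.out (Nat.pos_of_ne_zero ha)
  have hΦ₂ : (q ^ b).totient = q ^ (b - 1) * (q - 1) := Nat.totient_prime_pow hq.out (Nat.pos_of_ne_zero hb)
  have hpa : 1 ≤ p ^ (a - 1) := Nat.one_le_pow _ _ hp.out.pos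
  have hqb : 1 ≤ q ^ (b - 1) := Nat.one_le_pow _ _ hq.out.pos
  have hΦ₁ge : p - 1 ≤ (p ^ a).totient := by
    rw [hΦ₁]
    calc p - 1 = 1 * (p - 1) := (one_mul _).symm
      _ ≤ p ^ (a - 1) * (p - 1) := Nat.mul_le_mul_right _ hpa
  have hΦ₂ge : q - 1 ≤ (q ^ b).totient := by
    rw [hΦ₂]
    calc q - 1 = 1 * (q - 1) := (one_mul _).symm
      _ ≤ q ^ (b - 1) * (q - 1) := Nat.mul_le_mul_right _ hqb
  have hB2 := two_mul_card_side_le hp2 ha copr2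
  -- `q = 7` forces `p = 5`, and then both sides vanish
  rcases prime_ge_five_cases hq.out (by omega) with hq5 | hq7 | hq11
  · omega
  · have hp5' : p = 5 := by
      rcases prime_ge_five_cases hp.out hp5 with h | h | h
      · exact h
      · omega
      · omega
    subst hq7
    subst hp5'
    rw [card_side_eq_zero_of_pow_natCast_eq_neg_one hq2 hb copr1 five_cube_mod_seven,
      card_side_eq_zero_of_pow_natCast_eq_neg_one hp2 ha copr2 seven_sq_mod_five]
    exact Nat.mul_pos (Nat.totient_pos.2 (NeZero.pos _)) (Nat.totient_pos.2 (NeZero.pos _))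
  -- otherwise `q ≥ 11`, `Φ₂ ≥ 10`, `Φ₁ ≥ 4`
  have hΦ₂10 : 10 ≤ (q ^ b).totient := le_trans (by omega) hΦ₂ge
  have hΦ₁4 : 4 ≤ (p ^ a).totient := le_trans (by omega) hΦ₁ge
  rcases card_side_dichotomy hq2 hb copr1 with hA0 | ⟨hodd, hA⟩
  · exact twelve_mul_lt_of_bounds _ _ _ _ 0 hB2 hΦ₁4 hΦ₂10 (Or.inl hA0)
  obtain ⟨d, hd⟩ : ∃ d, orderOf (ZMod.unitOfCoprime p copr1) = d := ⟨_, rfl⟩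
  have hdvd : q ∣ p ^ d - 1 := by
    have h := dvd_pow_orderOf_sub_one copr1
    rw [hd] at h
    exact dvd_trans (dvd_pow_self q hb) h
  -- `d ≠ 1` since `p ≢ 1 (mod qᵇ)` (`1 < p < q ≤ qᵇ`)
  have hd1 : d ≠ 1 := by
    intro h1
    rw [← hd, orderOf_unitOfCoprime_eq_one_iff] at h1
    have hlt : p < q ^ b := lt_of_lt_of_le hpq (by
      calc q = q ^ 1 := (pow_one q).symm
        _ ≤ q ^ b := Nat.pow_le_pow_right hq.out.pos (Nat.one_le_iff_ne_zero.2 hb))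
    have h2 := (ZMod.natCast_eq_natCast_iff' p 1 (q ^ b)).1 (by rw [Nat.cast_one]; exact h1)
    rw [Nat.mod_eq_of_lt hlt, Nat.mod_eq_of_lt (lt_trans (by omega) hlt)] at h2
    omega
  rw [hd] at hodd hA
  have hd3 : 3 ≤ d := by
    obtain ⟨k, hk⟩ := hodd
    omega
  refine twelve_mul_lt_of_bounds _ _ _ _ d hB2 hΦ₁4 hΦ₂10 (Or.inr ⟨hd3, hA, fun hΦ₁6 hd3' => ?_⟩)
  -- `Φ₁ < 6` forces `p = 5`; `d = 3` gives `q ∣ 124 = 4·31`, so `q = 31`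
  have hp5' : p = 5 := by
    rcases prime_ge_five_cases hp.out hp5 with h | h | h
    · exact h
    · exfalso
      subst h
      omega
    · omega
  rw [hp5', hd3'] at hdvd
  norm_num at hdvd
  have hq31 : q = 31 := by
    rcases (Nat.Prime.dvd_mul hq.out).1 (show q ∣ 4 * 31 by simpa using hdvd) with h4 | h31
    · exfalso
      have := Nat.le_of_dvd (by norm_num) h4
      omega
    · exact (Nat.prime_dvd_prime_iff_eq hq.out (by norm_num)).1 h31
  subst hq31
  exact le_trans (by norm_num) hΦ₂ge

end TwoPrimes

/-! ## §4 The Proposition at two-prime levels: `12·#S₀(N) < φ(N)` for `N = pᵃqᵇ`, `p ≠ q` primes `≥ 5` -/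

section Proposition

/-- `ordCompl[p] (pᵃ·qᵇ) = qᵇ` for distinct primes. [folklore] -/
private theorem ordCompl_pow_mul_pow {p q a b : ℕ} (hp : p.Prime) (hq : q.Prime) (hpq : p ≠ q) :
    ordCompl[p] (p ^ a * q ^ b) = q ^ b := by
  rw [Nat.ordCompl_self_pow_mul (q ^ b) a hp, (Nat.ordCompl_eq_self_iff_zero_or_not_dvd _ hp).2]
  right
  intro h
  exact hpq ((Nat.prime_dvd_prime_iff_eq hp hq).1 (hp.dvd_of_dvd_pow h))

/-- **K–R's bound at a two-prime level, both sides**: for distinct primes `p, q ≥ 5` and `a, b ≥ 1`,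
`12·(#{ψ mod qᵇ odd : ψ(p) = 1} + #{ψ mod pᵃ odd : ψ(q) = 1}) < φ(pᵃ)φ(qᵇ)`. [cite: KoblitzRohrlich1978, §2 Proposition, Case 1 (pp. 1190–1191)] -/
theorem twelve_mul_card_sides_lt {p q a b : ℕ} [hp : Fact p.Prime] [hq : Fact q.Prime] (hp5 : 5 ≤ p) (hq5 : 5 ≤ q)
    (hpq : p ≠ q) (ha : a ≠ 0) (hb : b ≠ 0) :
    12 * (Nat.card {ψ : DirichletCharacter ℂ (q ^ b) // ψ.Odd ∧ ψ (p : ZMod (q ^ b)) = 1} +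
        Nat.card {ψ : DirichletCharacter ℂ (p ^ a) // ψ.Odd ∧ ψ (q : ZMod (p ^ a)) = 1}) <
      (p ^ a).totient * (q ^ b).totient := by
  rcases lt_or_gt_of_ne hpq with h | h
  · exact twelve_mul_card_sides_lt_of_lt hp5 h ha hb
  · rw [add_comm, mul_comm ((p ^ a).totient)]
    exact twelve_mul_card_sides_lt_of_lt hq5 h hb ha

/-- **THE PROPOSITION AT TWO-PRIME LEVELS** (`#S₀(N) < #S(N)/6`, i.e. `12·#S₀(N) < φ(N)`): for `N = pᵃqᵇ` with distinct primes `p, q ≥ 5`,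
twelve times the structural bound `Σ_{r ∣ N} #{ψ mod N_r odd : ψ(r) = 1}` of the sibling file is `< φ(N)`.
[cite: KoblitzRohrlich1978, §2 Proposition (p. 1190) and Case 1 (p. 1191)] -/
theorem twelve_mul_sum_card_lt_totient {p q a b N : ℕ} [hp : Fact p.Prime] [hq : Fact q.Prime] (hp5 : 5 ≤ p) (hq5 : 5 ≤ q)
    (hpq : p ≠ q) (ha : a ≠ 0) (hb : b ≠ 0) (hN : N = p ^ a * q ^ b) :
    12 * ∑ r ∈ N.primeFactors,
        Nat.card {ψ : DirichletCharacter ℂ (ordCompl[r] N) // ψ.Odd ∧ ψ (r : ZMod (ordCompl[r] N)) = 1} < N.totient := by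
  subst hN
  have hcop : (p ^ a).Coprime (q ^ b) := (((Nat.coprime_primes hp.out hq.out).2 hpq).pow_right b).pow_left a
  have hpf : (p ^ a * q ^ b).primeFactors = {p, q} := by
    rw [Nat.Coprime.primeFactors_mul hcop, Nat.primeFactors_prime_pow ha hp.out, Nat.primeFactors_prime_pow hb hq.out]
    rfl
  have h1 : ordCompl[p] (p ^ a * q ^ b) = q ^ b := ordCompl_pow_mul_pow hp.out hq.out hpq
  have h2 : ordCompl[q] (p ^ a * q ^ b) = p ^ a := by
    rw [mul_comm]
    exact ordCompl_pow_mul_pow hq.out hp.out hpq.symm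
  rw [hpf, Finset.sum_pair hpq, card_level_congr p h1, card_level_congr q h2, Nat.totient_mul hcop]
  exact twelve_mul_card_sides_lt hp5 hq5 hpq ha hb

/-- **`12·#S₀(N) < φ(N)` at two-prime levels, as the sibling's hypothesis**: a finset `S₀ ⊇ {χ mod N odd : B_{1,χ} = 0}` with `12·#S₀ < φ(N)`
exists for `N = pᵃqᵇ` (`p ≠ q` primes `≥ 5`). [cite: KoblitzRohrlich1978, §2 Proposition (p. 1190)] -/
theorem exists_goodFinset_two_primes {p q a b N : ℕ} [hp : Fact p.Prime] [hq : Fact q.Prime] [NeZero N] (hp5 : 5 ≤ p)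
    (hq5 : 5 ≤ q) (hpq : p ≠ q) (ha : a ≠ 0) (hb : b ≠ 0) (hN : N = p ^ a * q ^ b) :
    ∃ S₀ : Finset (DirichletCharacter ℂ N),
      (∀ ψ : DirichletCharacter ℂ N, ψ.Odd → bernoulliOneChar ψ = 0 → ψ ∈ S₀) ∧ 12 * S₀.card < N.totient :=
  exists_goodFinset_of_sum_lt (twelve_mul_sum_card_lt_totient hp5 hq5 hpq ha hb hN)

/-- **Koblitz–Rohrlich's Proposition in their normalisation at two-prime levels**: `6·#S₀(N) < #S(N)` would read `12·#S₀(N) < φ(N)`; here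
`#S₀(N)` itself: `12·#{χ mod N odd : B_{1,χ} = 0} < φ(N)` for `N = pᵃqᵇ`. [cite: KoblitzRohrlich1978, §2 Proposition (p. 1190)] -/
theorem twelve_mul_card_bad_lt_totient {p q a b N : ℕ} [hp : Fact p.Prime] [hq : Fact q.Prime] [NeZero N] (hp5 : 5 ≤ p)
    (hq5 : 5 ≤ q) (hpq : p ≠ q) (ha : a ≠ 0) (hb : b ≠ 0) (hN : N = p ^ a * q ^ b) :
    12 * Nat.card {χ : DirichletCharacter ℂ N // χ.Odd ∧ bernoulliOneChar χ = 0} < N.totient :=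
  lt_of_le_of_lt (Nat.mul_le_mul_left _ card_odd_bernoulliOneChar_eq_zero_le)
    (twelve_mul_sum_card_lt_totient hp5 hq5 hpq ha hb hN)

end Proposition

/-! ## §5 Koblitz–Rohrlich's Theorems 1 (i)–(ii) and 2, relatively prime case, UNCONDITIONALLY at two-prime levels `N = pᵃqᵇ` -/

section TwoPrimeLevel

open CategoryTheory
open Literature.AlgebraicGeometry.Motives (AbelianVariety)
open Literature.AlgebraicGeometry.HodgeTheory
open Literature.AlgebraicGeometry.Pohlmann1968 Literature.AlgebraicGeometry.Pohlmann1968.Cyclotomic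
open CyclotomicCMTypeResidueSets (IsCMResidueSet)

variable {p q a b N : ℕ} [hp : Fact p.Prime] [hq : Fact q.Prime] [NeZero N]

/-- At a two-prime level `N = pᵃqᵇ` (`p ≠ q` primes `≥ 5`): `1 < N` and `N` is odd. [folklore] -/
private theorem level_hyps₂ (hp5 : 5 ≤ p) (hq5 : 5 ≤ q) (ha : a ≠ 0) (hN : N = p ^ a * q ^ b) :
    1 < N ∧ Odd N := by
  subst hN
  have hp2 : p ≠ 2 := by omega
  have hq2 : q ≠ 2 := by omega
  refine ⟨?_, (hp.out.odd_of_ne_two hp2).pow.mul (hq.out.odd_of_ne_two hq2).pow⟩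
  calc 1 < p ^ a := Nat.one_lt_pow ha (by omega)
    _ ≤ p ^ a * q ^ b := Nat.le_mul_of_pos_right _ (pow_pos hq.out.pos b)

/-- **THEOREM 1 (i) at two-prime levels, unconditionally**: for `N = pᵃqᵇ` (`p ≠ q` primes `≥ 5`), unit triples `(r,s,t)`, `(r',s',t')` with
`r + s + t = 0 = r' + s' + t'` and a unit `h`: `H_{r',s',t'} = h⁻¹H_{r,s,t}` iff `{r',s',t'} = {hr, hs, ht}`.
[cite: KoblitzRohrlich1978, Theorem 1 (i) (p. 1185), §2 Lemma and Proposition (pp. 1188–1191)] -/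
theorem forall_mem_fermatCMType_iff_iff_multiset_eq_twoPrimes (hp5 : 5 ≤ p) (hq5 : 5 ≤ q) (hpq : p ≠ q) (ha : a ≠ 0)
    (hb : b ≠ 0) (hN : N = p ^ a * q ^ b) {r s t r' s' t' h : ZMod N}
    (hr : IsUnit r) (hs : IsUnit s) (ht : IsUnit t) (hrst : r + s + t = 0)
    (hr' : IsUnit r') (hs' : IsUnit s') (ht' : IsUnit t') (hrst' : r' + s' + t' = 0) (hh : IsUnit h) :
    (∀ x, x ∈ fermatCMType N r' s' t' ↔ h * x ∈ fermatCMType N r s t) ↔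
      ({r', s', t'} : Multiset (ZMod N)) = {h * r, h * s, h * t} := by
  obtain ⟨S₀, hS₀, hcard⟩ := exists_goodFinset_two_primes hp5 hq5 hpq ha hb hN
  obtain ⟨h1, h2⟩ := level_hyps₂ hp5 hq5 ha hN
  exact forall_mem_fermatCMType_iff_iff_multiset_eq_of_card h1 h2 S₀ hS₀ hcard hr hs ht hrst hr' hs' ht' hrst' hh

/-- **(∗) at two-prime levels**: `H_{r',s',t'} = H_{r,s,t}` iff `{r',s',t'} = {r,s,t}` for unit triples modulo `N = pᵃqᵇ`.
[cite: KoblitzRohrlich1978, §2 (∗) (p. 1187) and Proposition (p. 1190)] -/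
theorem fermatCMType_eq_iff_multiset_eq_twoPrimes (hp5 : 5 ≤ p) (hq5 : 5 ≤ q) (hpq : p ≠ q) (ha : a ≠ 0) (hb : b ≠ 0)
    (hN : N = p ^ a * q ^ b) {r s t r' s' t' : ZMod N}
    (hr : IsUnit r) (hs : IsUnit s) (ht : IsUnit t) (hrst : r + s + t = 0)
    (hr' : IsUnit r') (hs' : IsUnit s') (ht' : IsUnit t') (hrst' : r' + s' + t' = 0) :
    fermatCMType N r' s' t' = fermatCMType N r s t ↔ ({r', s', t'} : Multiset (ZMod N)) = {r, s, t} := by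
  obtain ⟨S₀, hS₀, hcard⟩ := exists_goodFinset_two_primes hp5 hq5 hpq ha hb hN
  obtain ⟨h1, h2⟩ := level_hyps₂ hp5 hq5 ha hN
  exact fermatCMType_eq_iff_multiset_eq_of_card h1 h2 S₀ hS₀ hcard hr hs ht hrst hr' hs' ht' hrst'

/-- **THEOREM 2's stabiliser at two-prime levels**: `wH_{1,a₀,−1−a₀} = H` iff `w = 1` or (`1 + a₀ + a₀² = 0` and `w ∈ {a₀, a₀²}`).
[cite: KoblitzRohrlich1978, Theorem 2 (pp. 1185–1186) and Proposition (p. 1190)] -/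
theorem forall_mem_fermatCMType_one_iff_mul_mem_iff_twoPrimes (hp5 : 5 ≤ p) (hq5 : 5 ≤ q) (hpq : p ≠ q) (ha : a ≠ 0)
    (hb : b ≠ 0) (hN : N = p ^ a * q ^ b) {a₀ w : ZMod N} (ha₀ : IsUnit a₀) (ha₁ : IsUnit (1 + a₀)) (hw : IsUnit w) :
    (∀ x, x ∈ fermatCMType N 1 a₀ (-1 - a₀) ↔ w * x ∈ fermatCMType N 1 a₀ (-1 - a₀)) ↔
      w = 1 ∨ (1 + a₀ + a₀ ^ 2 = 0 ∧ (w = a₀ ∨ w = a₀ ^ 2)) := by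
  obtain ⟨S₀, hS₀, hcard⟩ := exists_goodFinset_two_primes hp5 hq5 hpq ha hb hN
  obtain ⟨h1, h2⟩ := level_hyps₂ hp5 hq5 ha hN
  exact forall_mem_fermatCMType_one_iff_mul_mem_iff_of_card h1 h2 S₀ hS₀ hcard ha₀ ha₁ hw

variable {L : Type} [Field L] [NumberField L] [IsCyclotomicExtension {N} ℚ L]
  {A A' : AbelianVariety ℂ} {ι : 𝓞 L →+* End A} {θ : L →+* Module.End ℂ (complexBetti A.X 1)}
  {ι' : 𝓞 L →+* End A'} {θ' : L →+* Module.End ℂ (complexBetti A'.X 1)}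

/-- **THEOREM 2 on CM types at two-prime levels**: `Φ_{(1,a₀,−1−a₀)}` of `ℚ(ζ_N)`, `N = pᵃqᵇ`, is primitive iff NOT (`1 + a₀ + a₀² = 0` and `a₀ ≠ 1`).
[cite: KoblitzRohrlich1978, Theorem 2 (pp. 1185–1186) and Proposition (p. 1190)] [cite: Shimura1998, §8.2 Prop. 26] -/
theorem isPrimitive_fermat_one_iff_twoPrimes (hp5 : 5 ≤ p) (hq5 : 5 ≤ q) (hpq : p ≠ q) (ha : a ≠ 0) (hb : b ≠ 0)
    (hN : N = p ^ a * q ^ b) {a₀ : ZMod N} (ha₀ : IsUnit a₀) (ha₁ : IsUnit (1 + a₀))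
    {hS : ∀ c : ZMod N, c.val.Coprime N → (c ∈ fermatCMType N 1 a₀ (-1 - a₀) ↔ -c ∉ fermatCMType N 1 a₀ (-1 - a₀))}
    (φ₀ : L →+* ℂ) :
    IsPrimitive (ℂ ≃+* ℂ) (cmTypeOfResidues (L := L) (fermatCMType N 1 a₀ (-1 - a₀)) hS).1 φ₀ ↔
      ¬(1 + a₀ + a₀ ^ 2 = 0 ∧ a₀ ≠ 1) := by
  obtain ⟨S₀, hS₀, hcard⟩ := exists_goodFinset_two_primes hp5 hq5 hpq ha hb hN
  obtain ⟨h1, h2⟩ := level_hyps₂ hp5 hq5 ha hN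
  exact isPrimitive_fermat_one_iff_of_card h1 h2 S₀ hS₀ hcard ha₀ ha₁ φ₀

/-- **THEOREM 2 on abelian varieties at two-prime levels**: an abelian variety of type `(ℚ(ζ_N); Φ_{(1,a₀,−1−a₀)})`, `N = pᵃqᵇ`, is SIMPLE iff NOT
(`1 + a₀ + a₀² = 0` and `a₀ ≠ 1`). [cite: KoblitzRohrlich1978, Theorem 2 (pp. 1185–1186) and Proposition (p. 1190)] [cite: Shimura1998, §8.2 Prop. 26] -/
theorem isSimple_of_fermat_one_iff_twoPrimes (hp5 : 5 ≤ p) (hq5 : 5 ≤ q) (hpq : p ≠ q) (ha : a ≠ 0) (hb : b ≠ 0)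
    (hN : N = p ^ a * q ^ b) {a₀ : ZMod N} (ha₀ : IsUnit a₀) (ha₁ : IsUnit (1 + a₀))
    {hS : ∀ c : ZMod N, c.val.Coprime N → (c ∈ fermatCMType N 1 a₀ (-1 - a₀) ↔ -c ∉ fermatCMType N 1 a₀ (-1 - a₀))}
    (hA : IsCMTypeRealisation (cmTypeOfResidues (L := L) (fermatCMType N 1 a₀ (-1 - a₀)) hS) A ι θ) :
    A.IsSimple ↔ ¬(1 + a₀ + a₀ ^ 2 = 0 ∧ a₀ ≠ 1) := by
  obtain ⟨S₀, hS₀, hcard⟩ := exists_goodFinset_two_primes hp5 hq5 hpq ha hb hN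
  obtain ⟨h1, h2⟩ := level_hyps₂ hp5 hq5 ha hN
  exact isSimple_of_fermat_one_iff_of_card h1 h2 S₀ hS₀ hcard ha₀ ha₁ hA

/-- **THEOREM 1 (ii) at two-prime levels** ("the only isogenies between the lattices `L_{r,s,t}` are the obvious equalities"): for unit triples
modulo `N = pᵃqᵇ`, abelian varieties of types `Φ_{H_{r,s,t}}`, `Φ_{H_{r',s',t'}}` are isogenous iff `{r',s',t'} = u·{r,s,t}` for a unit `u`.
[cite: KoblitzRohrlich1978, Theorem 1 (ii) (p. 1185) and Proposition (p. 1190)] [cite: Shimura1998, §8.4 Example (1) and §6.1 Corollary] -/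
theorem isIsogenous_fermatCMType_iff_exists_multiset_eq_twoPrimes [IsCMField L] (hp5 : 5 ≤ p) (hq5 : 5 ≤ q) (hpq : p ≠ q)
    (ha : a ≠ 0) (hb : b ≠ 0) (hN : N = p ^ a * q ^ b) {r s t r' s' t' : ZMod N}
    (hr : IsUnit r) (hs : IsUnit s) (ht : IsUnit t) (hrst : r + s + t = 0)
    (hr' : IsUnit r') (hs' : IsUnit s') (ht' : IsUnit t') (hrst' : r' + s' + t' = 0)
    (hS : IsCMResidueSet N (fermatCMType N r s t)) (hS' : IsCMResidueSet N (fermatCMType N r' s' t'))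
    (hA : IsCMTypeRealisation (cmTypeOfResidues (L := L) (fermatCMType N r s t) hS.cm) A ι θ)
    (hA' : IsCMTypeRealisation (cmTypeOfResidues (L := L) (fermatCMType N r' s' t') hS'.cm) A' ι' θ') :
    AbelianVariety.IsIsogenous A A' ↔
      ∃ u : ZMod N, IsUnit u ∧ ({r', s', t'} : Multiset (ZMod N)) = {u * r, u * s, u * t} := by
  obtain ⟨S₀, hS₀, hcard⟩ := exists_goodFinset_two_primes hp5 hq5 hpq ha hb hN
  obtain ⟨h1, h2⟩ := level_hyps₂ hp5 hq5 ha hN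
  exact isIsogenous_fermatCMType_iff_exists_multiset_eq_of_card h1 h2 S₀ hS₀ hcard hr hs ht hrst hr' hs' ht' hrst' hS hS'
    hA hA'

/-- **Non-vacuity at two-prime levels**: for units `a₀`, `1 + a₀` modulo `N = pᵃqᵇ` with NOT (`1 + a₀ + a₀² = 0 ∧ a₀ ≠ 1`) there is a SIMPLE
abelian variety of dimension `φ(N)/2` of type `Φ_{(1,a₀,−1−a₀)}`. [cite: Shimura1998, §6.2 Thm. 3] [cite: KoblitzRohrlich1978, Theorem 2] -/
theorem exists_isSimple_of_fermat_one_twoPrimes (hp5 : 5 ≤ p) (hq5 : 5 ≤ q) (hpq : p ≠ q) (ha : a ≠ 0) (hb : b ≠ 0)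
    (hN : N = p ^ a * q ^ b) {a₀ : ZMod N} (ha₀ : IsUnit a₀) (ha₁ : IsUnit (1 + a₀)) (H : ¬(1 + a₀ + a₀ ^ 2 = 0 ∧ a₀ ≠ 1))
    (hS : ∀ c : ZMod N, c.val.Coprime N → (c ∈ fermatCMType N 1 a₀ (-1 - a₀) ↔ -c ∉ fermatCMType N 1 a₀ (-1 - a₀))) :
    ∃ (B : AbelianVariety ℂ) (ι' : 𝓞 L →+* End B) (θ' : L →+* Module.End ℂ (complexBetti B.X 1)),
      IsCMTypeRealisation (cmTypeOfResidues (L := L) (fermatCMType N 1 a₀ (-1 - a₀)) hS) B ι' θ' ∧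
        B.IsSimple ∧ B.dim = N.totient / 2 := by
  obtain ⟨S₀, hS₀, hcard⟩ := exists_goodFinset_two_primes hp5 hq5 hpq ha hb hN
  obtain ⟨h1, h2⟩ := level_hyps₂ hp5 hq5 ha hN
  exact exists_isSimple_of_fermat_one_of_card h1 h2 S₀ hS₀ hcard ha₀ ha₁ H hS

end TwoPrimeLevel

end CyclotomicFermatCMType

end Literature.AlgebraicGeometry.ComplexMultiplication
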